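import Mathlib

/-!
# V4U piece 0 — the root-chart action `σ_U` of `J₄` on `k[ρ, β, γ, δ, …]`: existence as an automorphism and the intertwining `ψ_A ∘ σ = σ_U ∘ ψ_A`

(crux stmt-ResolutionOfSingularities-15640 `WildQuotients.WildQuotientResolution`, line `Sketch`,
sector `|G| = p`; programme V4U of `L/w45c/CHAIN.md` v7.5a («instance lemmas» tail of row stub-1:
inputs for the `μ₃` ring brick H₀, res-type-087, which instantiates the ABSTRACT `σ_U` of
`JordanFour.chart0_fixedPoints_eq_*` / `JordanFour.phiZero₁/₂`); `L/w45c/V4U-DESIGN.md` §2.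
[OURS · L1 W4.5c] — NOT a statement of any manuscript; replaces the role of no printed item.
Prover res-L1-w45c-stub-1. Route-independent: `import Mathlib` only.)

Root substitution of the chart `D₊(x_a² t)` (res-L1-w45c-stub-2's `JordanFour.chart0_ringEquiv_adjoin`,
p490009, literal): `ψ_A : x_a ↦ X a³`, `x_b ↦ X b·X a²`, `x_c ↦ X c·X a`, `x_i ↦ X i·X a⁰` otherwise
(slots `ρ = X a`, `β = X b`, `γ = X c`, `δ = X d`). The Jordan block `σ` (`x_b ↦ x_b + x_a`,
`x_c ↦ x_c + x_b`, `x_d ↦ x_d + x_c`) lifts to the TRIANGULAR translation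
`σ_U : ρ ↦ ρ, β ↦ β + ρ, γ ↦ γ + ρβ, δ ↦ δ + ργ` (passengers fixed):
* `exists_rootChart0Equiv` — `σ_U` exists as a `k`-algebra AUTOMORPHISM with this law
  (inverse `β ↦ β − ρ`, `γ ↦ γ − ρ(β − ρ)`, `δ ↦ δ − ρ(γ − ρ(β − ρ))`);
* `rootSubst0_comp_eq` / `rootSubst0_map` — **`ψ_A ∘ σ = σ_U ∘ ψ_A`** for ANY `k`-algebra
  endomorphisms `σ`, `σ_U` with the two laws (the `μ₃` analogue of T-i `JordanFour.twistedChart_comp_eq`).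
-/

-- single-problem summit: the doubled namespace component `ResolutionOfSingularities` is forced
set_option linter.dupNamespace false

noncomputable section

open MvPolynomial

namespace Summit.ResolutionOfSingularities.ResolutionOfSingularities.Theorems.WildQuotientResolution.JordanFour

variable (k : Type) [Field k] (n : ℕ) (a b c d : Fin n)
  (hab : a ≠ b) (hac : a ≠ c) (had : a ≠ d) (hbc : b ≠ c) (hbd : b ≠ d) (hcd : c ≠ d)

include hab hac had hbc hbd hcd in
/-- **The root-chart action exists as an automorphism**: there is `σ_U : k[x] ≃ₐ[k] k[x]` with
`σ_U (X b) = X b + X a`, `σ_U (X c) = X c + X a·X b`, `σ_U (X d) = X d + X a·X c`, `σ_U (X i) = X i`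
otherwise. [OURS · L1 W4.5c] -/
theorem exists_rootChart0Equiv :
    ∃ σU : MvPolynomial (Fin n) k ≃ₐ[k] MvPolynomial (Fin n) k,
      σU (X b) = X b + X a ∧ σU (X c) = X c + X a * X b ∧ σU (X d) = X d + X a * X c ∧
        ∀ i, i ≠ b → i ≠ c → i ≠ d → σU (X i) = X i := by
  classical
  let φ : MvPolynomial (Fin n) k →ₐ[k] MvPolynomial (Fin n) k :=
    aeval fun i => if i = b then X b + X a else if i = c then X c + X a * X b
      else if i = d then X d + X a * X c else X i
  let φ' : MvPolynomial (Fin n) k →ₐ[k] MvPolynomial (Fin n) k :=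
    aeval fun i => if i = b then X b - X a else if i = c then X c - X a * (X b - X a)
      else if i = d then X d - X a * (X c - X a * (X b - X a)) else X i
  have hφb : φ (X b) = X b + X a := by simp [φ]
  have hφc : φ (X c) = X c + X a * X b := by simp [φ, Ne.symm hbc]
  have hφd : φ (X d) = X d + X a * X c := by simp [φ, Ne.symm hbd, Ne.symm hcd]
  have hφi : ∀ i, i ≠ b → i ≠ c → i ≠ d → φ (X i) = X i := by
    intro i hib hic hid; simp [φ, hib, hic, hid]
  have hφ'b : φ' (X b) = X b - X a := by simp [φ']
  have hφ'c : φ' (X c) = X c - X a * (X b - X a) := by simp [φ', Ne.symm hbc]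
  have hφ'd : φ' (X d) = X d - X a * (X c - X a * (X b - X a)) := by
    simp [φ', Ne.symm hbd, Ne.symm hcd]
  have hφ'i : ∀ i, i ≠ b → i ≠ c → i ≠ d → φ' (X i) = X i := by
    intro i hib hic hid; simp [φ', hib, hic, hid]
  have hφa : φ (X a) = X a := hφi a hab hac had
  have hφ'a : φ' (X a) = X a := hφ'i a hab hac had
  have h1 : φ.comp φ' = AlgHom.id k _ := by
    refine MvPolynomial.algHom_ext fun i => ?_
    change φ (φ' (X i)) = X i
    by_cases hib : i = b
    · rw [hib, hφ'b, map_sub, hφb, hφa]; ring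
    by_cases hic : i = c
    · rw [hic, hφ'c, map_sub, map_mul, map_sub, hφc, hφa, hφb]; ring
    by_cases hid : i = d
    · rw [hid, hφ'd, map_sub, map_mul, map_sub, map_mul, map_sub, hφd, hφa, hφc, hφb]; ring
    · rw [hφ'i i hib hic hid, hφi i hib hic hid]
  have h2 : φ'.comp φ = AlgHom.id k _ := by
    refine MvPolynomial.algHom_ext fun i => ?_
    change φ' (φ (X i)) = X i
    by_cases hib : i = b
    · rw [hib, hφb, map_add, hφ'b, hφ'a]; ring
    by_cases hic : i = c
    · rw [hic, hφc, map_add, map_mul, hφ'c, hφ'a, hφ'b]; ring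
    by_cases hid : i = d
    · rw [hid, hφd, map_add, map_mul, hφ'd, hφ'a, hφ'c]; ring
    · rw [hφi i hib hic hid, hφ'i i hib hic hid]
  exact ⟨AlgEquiv.ofAlgHom φ φ' h1 h2, hφb, hφc, hφd, hφi⟩

variable (σ : MvPolynomial (Fin n) k →ₐ[k] MvPolynomial (Fin n) k)
  (hσb : σ (X b) = X b + X a) (hσc : σ (X c) = X c + X b) (hσd : σ (X d) = X d + X c)
  (hσ : ∀ i, i ≠ b → i ≠ c → i ≠ d → σ (X i) = X i)
  (σU : MvPolynomial (Fin n) k →ₐ[k] MvPolynomial (Fin n) k)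
  (hUb : σU (X b) = X b + X a) (hUc : σU (X c) = X c + X a * X b) (hUd : σU (X d) = X d + X a * X c)
  (hU : ∀ i, i ≠ b → i ≠ c → i ≠ d → σU (X i) = X i)

include hab hac had hbc hbd hcd hσb hσc hσd hσ hUb hUc hUd hU in
/-- **`ψ_A ∘ σ = σ_U ∘ ψ_A`** for the chart-`0` root substitution `ψ_A` (literal of p490009): the
Jordan block becomes the triangular root-chart translation. [OURS · L1 W4.5c] -/
theorem rootSubst0_comp_eq :
    (MvPolynomial.aeval (fun s : Fin n => (if s = a then X a ^ 3 else
        X s * X a ^ (if s = b then 2 else if s = c then 1 else 0) : MvPolynomial (Fin n) k)) :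
        MvPolynomial (Fin n) k →ₐ[k] MvPolynomial (Fin n) k).comp σ =
      σU.comp (MvPolynomial.aeval (fun s : Fin n => (if s = a then X a ^ 3 else
        X s * X a ^ (if s = b then 2 else if s = c then 1 else 0) : MvPolynomial (Fin n) k))) := by
  classical
  set ψ : MvPolynomial (Fin n) k →ₐ[k] MvPolynomial (Fin n) k :=
    MvPolynomial.aeval (fun s : Fin n => (if s = a then X a ^ 3 else
      X s * X a ^ (if s = b then 2 else if s = c then 1 else 0) : MvPolynomial (Fin n) k)) with hψ
  have hψa : ψ (X a) = X a ^ 3 := by rw [hψ, aeval_X, if_pos rfl]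
  have hψb : ψ (X b) = X b * X a ^ 2 := by rw [hψ, aeval_X, if_neg (Ne.symm hab), if_pos rfl]
  have hψc : ψ (X c) = X c * X a ^ 1 := by
    rw [hψ, aeval_X, if_neg (Ne.symm hac), if_neg (Ne.symm hbc), if_pos rfl]
  have hψi : ∀ i, i ≠ a → i ≠ b → i ≠ c → ψ (X i) = X i * X a ^ 0 := by
    intro i hia hib hic; rw [hψ, aeval_X, if_neg hia, if_neg hib, if_neg hic]
  have hψd : ψ (X d) = X d * X a ^ 0 := hψi d (Ne.symm had) (Ne.symm hbd) (Ne.symm hcd)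
  have hσa : σ (X a) = X a := hσ a hab hac had
  have hUa : σU (X a) = X a := hU a hab hac had
  refine MvPolynomial.algHom_ext fun i => ?_
  change ψ (σ (X i)) = σU (ψ (X i))
  by_cases hia : i = a
  · rw [hia, hσa, hψa, map_pow, hUa]
  by_cases hib : i = b
  · rw [hib, hσb, map_add, hψb, hψa, map_mul, map_pow, hUb, hUa]; ring
  by_cases hic : i = c
  · rw [hic, hσc, map_add, hψc, hψb, map_mul, map_pow, hUc, hUa]; ring
  by_cases hid : i = d
  · rw [hid, hσd, map_add, hψd, hψc, map_mul, map_pow, hUd, hUa]; ring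
  · rw [hσ i hib hic hid, hψi i hia hib hic, map_mul, map_pow, hU i hib hic hid, hUa]

include hab hac had hbc hbd hcd hσb hσc hσd hσ hUb hUc hUd hU in
/-- Pointwise form: `ψ_A (σ f) = σ_U (ψ_A f)`. [OURS · L1 W4.5c] -/
theorem rootSubst0_map (f : MvPolynomial (Fin n) k) :
    MvPolynomial.aeval (fun s : Fin n => (if s = a then X a ^ 3 else
        X s * X a ^ (if s = b then 2 else if s = c then 1 else 0) : MvPolynomial (Fin n) k)) (σ f) =
      σU (MvPolynomial.aeval (fun s : Fin n => (if s = a then X a ^ 3 else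
        X s * X a ^ (if s = b then 2 else if s = c then 1 else 0) : MvPolynomial (Fin n) k)) f) := by
  have h := rootSubst0_comp_eq k n a b c d hab hac had hbc hbd hcd σ hσb hσc hσd hσ σU hUb hUc hUd hU
  exact congrArg (fun φ : MvPolynomial (Fin n) k →ₐ[k] MvPolynomial (Fin n) k => φ f) h

end Summit.ResolutionOfSingularities.ResolutionOfSingularities.Theorems.WildQuotientResolution.JordanFour

end
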